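import Mathlib
import Literature.NumberTheory.Irrationality.Lai2025TwoAdic.RationalFunctionB
import HarnessLib

/-!
# Lai 2025 (IJNT, `2`-adic zeta values), §3–§5 for GENERAL `s`: the rational function
# `B_n(t) = 2^{(3s+6)n}(t+¾)_n^{s+2}/(t)_{n+1}^{s+2}`, its partial fractions (def_b), Lemma 4.2 and the
# coefficient estimate of Lemma 5.2 — PROVED

Topic `Literature/NumberTheory/Irrationality/Lai2025TwoAdic`.  Source: L. Lai, *On the irrationality of certain
`2`-adic zeta values*, Int. J. Number Theory (2025) = arXiv:2304.00816 [Lai2025TwoAdicZeta] (held text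
`paper:arxiv-2304.00816`, chunks p0007–p0008 = §3 "Rational functions and linear forms" and §4 "Arithmetic
properties of the coefficients", p0010 = §5 "Archimedean norm of the coefficients", read on the page).  PROOF FILE
(definitions with bodies + theorems; no named fact, net debt 0).  It is file 1 of the discharge of the tree's named
fact `PAdicZetaValues.lai2025TwoAdic_theorem13` ([Lai2025TwoAdicZeta, Thm 1.3]: «For any nonnegative integer `s`, the
following set contains at least one irrational number: `{ζ₂(j,¼) | j ∈ ℤ ∩ [s+3, 2s+3]}`») for GENERAL `s`; the case
`s = 0` is the tree's `RationalFunctionB.lean` (`B`, `Breg`, `coeffB`, …), whose bricks `quarterBrick`, `Pk` are reused.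

## Source, as printed

* **Definition 3.1.** «Fix a nonnegative integer `s` … For every positive integer `n` we define …
  `B_n(t) := 2^{(3s+6)n} · (t+¾)_n^{s+2}/(t)_{n+1}^{s+2}`.  … Both `A_n(t)` and `B_n(t)` have degree `≤ −2`.  We define
  their partial fraction decompositions by … `B_n(t) =: Σ_{i=1}^{s+2} Σ_{k=0}^{n} b_{n,i,k}/(t+k)^i` [(def_b)].»
* **Lemma 4.1** (`F_{3/4}(t) := 2^{3n}(t+¾)_n/n!`, `G(t) := n!/(t)_{n+1}`): «for any integer `k ∈ [0,n]` and any
  nonnegative integer `ℓ`, we have `d_n^ℓ · (1/ℓ!) F_{3/4}^{(ℓ)}(t)|_{t=−k} ∈ ℤ`, `d_n^ℓ · (1/ℓ!)((t+k)G(t))^{(ℓ)}|_{t=−k} ∈ ℤ`.»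
  (tree: `quarterBrick_isDInt`, `RivoalZudilin2020.Greg_isDInt`).
* **Lemma 4.2.** «`d_n^{s+2−i} b_{n,i,k} ∈ ℤ. (1 ≤ i ≤ s+2, 0 ≤ k ≤ n)` [(ari_b)] … *Proof.* …
  `b_{n,i,k} = (1/(s+2−i)!)((t+k)^{s+2}B_n(t))^{(s+2−i)}|_{t=−k}` [the `B`-analogue of (eqn_a=deri)] … Note that
  `(t+k)^{s+2}B_n(t) = F_{3/4}(t)^{s+2}·((t+k)G(t))^{s+2}`.  Applying the Leibniz rule and Lemma 4.1 …»
* (From the proof of Lemma 3.3:) «we have `σ_{n,1} = 0` since `deg B_n(t) ≤ −2`» — i.e. `Σ_k b_{n,1,k} = 0`.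
* **Lemma 5.2.** «`max_{0≤i≤s+2}|σ_{n,i}| ≤ 2^{(3s+6+o(1))n}`.  *Proof.* … It suffices to show that
  `max_{i,k}|a_{n,i,k}| ≤ 2^{(6s+12+o(1))n}` [resp. `|b_{n,i,k}| ≤ 2^{(3s+6+o(1))n}`].  By Cauchy's integral formula …
  `max_{|t+k|=⅛}|(t+¾)_n| ≤ k!(n−k)!`, `max_{|t+k|=⅛}|(t)_{n+1}^{−1}| ≤ 100n²/(k!(n−k)!)`.»
* §6, proof of Lemma 6.3: «`B_n(t+¼) = 2^{(5s+10)n+2s+4}·f(t)`, where `f(t) = (t+1)^{s+2}(t+2)^{s+2}⋯(t+n)^{s+2}g(t)` and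
  `g(t) = ∏_{k=0}^{n}(4t+4k+1)^{−(s+2)}`.»

## What is formalised (all PROVED)

* `Bs s n` = Definition 3.1; `BsReg s n k = Pk n k ^ (s+2)` = `(t+k)^{s+2}B_n(t)` in brick form, regular at `−k`
  (`BsReg_eq`, `Pk_eq`); `BsReg_isDInt` (Lemma 4.1 + Leibniz, via the tree's `IsDInt.pow`).
* `coeffBs s n i k := 𝒟_{s+2−i}(BsReg s n k)(−k)` = `b_{n,i,k}`; **Lemma 4.2 (ari_b)** `exists_int_lcm_pow_mul_coeffBs`;
  the expansion **(def_b)** off the poles: `exists_Bs_eq_pfEval` (tree `exists_pfEval_eq_eval_mul_prod_inv`, the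
  shifts `0,…,n` with multiplicity `s+2` = `powShifts n (s+2)`), `coeffBs_eq_of_pfEval` («uniquely determined»),
  `Bs_eq_sum_coeffBs`; `coeffBs_top_eq` (`b_{n,s+2,k} = P_k(−k)^{s+2}`).
* **`σ_{n,1} = 0`**: `sum_coeffBs_one_eq_zero` (`Σ_k b_{n,1,k} = lim_{t→∞} tB_n(t) = 0`).
* **Lemma 5.2 for the coefficients**, DEVIATION (flagged in §3 below): instead of Cauchy's integral formula on
  `|t+k| = ⅛` the bound is obtained from TERMWISE geometric bounds on Taylor coefficients (`TaylorBound`, closed under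
  products: linear bricks `t+a`, inverse bricks `(t+a)^{−1}`, constants), giving the same exponential rate with an
  explicit polynomial factor: `abs_coeffBs_le` — `|b_{n,i,k}| ≤ 2^{(3s+6)n}·(5(s+2)n)^{s+2−i}` (`c_P(n,k) ≤ 5n`, `cP_le`;
  `|P_k(−k)| ≤ 2^{3n}` is the tree's `abs_Pk_neg_le`).
* `Bs_add_quarter`, `Bs_natCast_add_quarter`: the product form of `B_n(x+¼)` (the §6 display for `f`, `g`).

The linear forms `T_n` (Definition 3.2, Lemma 3.3), Lemmas 4.5–4.6 and the `σ`-bounds are in the sibling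
`GeneralLinearFormsT.lean`.  Cell zeta5-irr / pub-zeta5 (HONEST FRAMING: systematic search; no irrationality claim
unless kernel-certified): `2`-adic preliminaries for `ζ₂(j,¼)`; nothing here bears on `ζ(5) ∈ ℝ`.
-/

noncomputable section

open Finset Filter Polynomial Literature.Analysis.Calculus
open Literature.NumberTheory.Transcendental
open Literature.NumberTheory.Irrationality.RivoalZudilin2020 (Greg Greg_eq Greg_isDInt)
open Literature.NumberTheory.Irrationality.LaiSprangZudilin2026 (divDeriv_eq_coeff_of_pfEval)
open Literature.NumberTheory.Irrationality.LaiSprangZudilin2026.Lemma53 (Greg_neg)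
open scoped Nat Topology

namespace Literature.NumberTheory.Irrationality.Lai2025TwoAdic

/-! ## §1. Definition 3.1 for general `s`: `B_n(t)` and its brick form `P_k(t)^{s+2}` -/

/-- **Definition 3.1** (general `s`): `B_n(t) := 2^{(3s+6)n} · (t+¾)_n^{s+2} / (t)_{n+1}^{s+2}`
(degree `(s+2)n − (s+2)(n+1) = −(s+2) ≤ −2`). [cite: Lai2025TwoAdicZeta, Definition 3.1 (B_n(t))] -/
def Bs (s n : ℕ) (t : ℚ) : ℚ :=
  (2 : ℚ) ^ ((3 * s + 6) * n) * (∏ j ∈ range n, (t + 3 / 4 + j)) ^ (s + 2) /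
    (∏ j ∈ range (n + 1), (t + j)) ^ (s + 2)

/-- The BRICK FORM of `(t+k)^{s+2}B_n(t)`, regular at `t = −k`: `P_k(t)^{s+2}` with
`P_k = F_{3/4}·((t+k)G)` (tree `Pk n k = quarterBrick 3 n · Greg n k`).
[cite: Lai2025TwoAdicZeta, Lemma 4.2 (proof: "(t+k)^{s+2}B_n(t) = F_{3/4}(t)^{s+2}((t+k)G(t))^{s+2}")] -/
def BsReg (s n k : ℕ) (t : ℚ) : ℚ := Pk n k t ^ (s + 2)

/-- `P_k(t) = 2^{3n} (∏_{j<n}(t+¾+j)) (t+k) / ∏_{l≤n}(t+l)` off the poles and off `−k`.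
[cite: Lai2025TwoAdicZeta, Lemma 4.2 (proof: F_{3/4} = 2^{3n}(t+¾)_n/n!, G = n!/(t)_{n+1})] -/
theorem Pk_eq (n k : ℕ) {t : ℚ} (ht : ∀ j ∈ range (n + 1), t + j ≠ 0) (htk : t + k ≠ 0) :
    Pk n k t = (2 : ℚ) ^ (3 * n) * (∏ j ∈ range n, (t + 3 / 4 + j)) * (t + k) /
      ∏ j ∈ range (n + 1), (t + j) := by
  have hprod : ∏ j ∈ range (n + 1), (t + j) ≠ 0 := prod_ne_zero_iff.2 ht
  have hfac : (n ! : ℚ) ≠ 0 := by exact_mod_cast Nat.factorial_ne_zero n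
  unfold Pk quarterBrick
  rw [Greg_eq_mul_prod_inv n k htk, prod_inv_distrib]
  have e : ∏ j ∈ range n, (t + (((3 : ℤ) : ℚ) / 4 + j)) = ∏ j ∈ range n, (t + 3 / 4 + j) :=
    prod_congr rfl fun j _ => by push_cast; ring
  rw [e]
  field_simp

/-- Off the poles `0, −1, …, −n` and off `−k`: `BsReg s n k t = B_n(t)·(t+k)^{s+2}`.
[cite: Lai2025TwoAdicZeta, Lemma 4.2 (proof)] -/
theorem BsReg_eq (s n k : ℕ) {t : ℚ} (ht : ∀ j ∈ range (n + 1), t + j ≠ 0) (htk : t + k ≠ 0) :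
    BsReg s n k t = Bs s n t * (t + k) ^ (s + 2) := by
  have hprod : ∏ j ∈ range (n + 1), (t + j) ≠ 0 := prod_ne_zero_iff.2 ht
  rw [BsReg, Pk_eq n k ht htk, Bs, div_pow, mul_pow, mul_pow, ← pow_mul,
    show 3 * n * (s + 2) = (3 * s + 6) * n by ring]
  field_simp

/-- `BsReg s n k` is smooth at every `x` off the poles other than `−k`. [cite: Lai2025TwoAdicZeta, Lemma 4.2 (proof)] -/
theorem contDiffAt_BsReg (s n k : ℕ) {x : ℚ} (hx : ∀ l ∈ range (n + 1), l ≠ k → x + l ≠ 0)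
    {N : WithTop ℕ∞} : ContDiffAt ℚ N (BsReg s n k) x := by
  unfold BsReg Pk
  exact ((contDiffAt_quarterBrick 3 n x).mul (contDiffAt_Greg n k hx)).pow _

/-- `−k` is off the other poles. [folklore] -/
private theorem neg_add_ne_zero_of_ne' {k l : ℕ} (h : l ≠ k) : (-(k : ℚ)) + l ≠ 0 := by
  rw [show (-(k : ℚ) + l) = ((l : ℤ) - (k : ℤ) : ℤ) by push_cast; ring]
  exact_mod_cast sub_ne_zero.2 (by exact_mod_cast h : (l : ℤ) ≠ k)

/-- `BsReg s n k` is smooth at `−k`. [cite: Lai2025TwoAdicZeta, Lemma 4.2 (proof)] -/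
theorem contDiffAt_BsReg_neg (s n k : ℕ) {N : WithTop ℕ∞} : ContDiffAt ℚ N (BsReg s n k) (-(k : ℚ)) :=
  contDiffAt_BsReg s n k fun _ _ hl => neg_add_ne_zero_of_ne' hl

/-- **`d_n^j · 𝒟_j((t+k)^{s+2}B_n(t))(−k) ∈ ℤ`** for all `j` (`k ≤ n`): Leibniz over the `s+2` bricks `F_{3/4}`
(Lemma 4.1, tree `quarterBrick_isDInt`) and the `s+2` bricks `(t+k)G(t)` (Lemma 4.1, tree `Greg_isDInt`).
[cite: Lai2025TwoAdicZeta, Lemma 4.2 (proof)] -/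
theorem BsReg_isDInt (s n : ℕ) {k : ℕ} (hk : k ≤ n) (N : ℕ) :
    IsDInt (Nat.lcmUpto n) N (BsReg s n k) (-(k : ℚ)) := by
  have hF : IsDInt (Nat.lcmUpto n) N (quarterBrick 3 n) (-(k : ℚ)) := by
    simpa using quarterBrick_isDInt 3 n (-(k : ℤ)) N
  have hP : IsDInt (Nat.lcmUpto n) N (Pk n k) (-(k : ℚ)) := hF.mul (Greg_isDInt n hk N)
  exact hP.pow (s + 2)

/-! ## §2. The coefficients `b_{n,i,k}` of (def_b) and Lemma 4.2 (general `s`) -/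

/-- The coefficient `b_{n,i,k}` of (def_b), DEFINED as the Taylor coefficient
`𝒟_{s+2−i}((t+k)^{s+2}B_n(t))|_{t=−k}` of the brick form
(«`b_{n,i,k} = (1/(s+2−i)!)((t+k)^{s+2}B_n(t))^{(s+2−i)}|_{t=−k}`»).
[cite: Lai2025TwoAdicZeta, Definition 3.1 (def_b) and Lemma 4.2 (proof, first display)] -/
def coeffBs (s n i k : ℕ) : ℚ := divDeriv (s + 2 - i) (BsReg s n k) (-(k : ℚ))

/-- **Lemma 4.2 (ari_b), general `s`:** `d_n^{s+2−i} · b_{n,i,k} ∈ ℤ` (`1 ≤ i ≤ s+2`, `0 ≤ k ≤ n`; here for every `i`).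
[cite: Lai2025TwoAdicZeta, Lemma 4.2 (ari_b)] -/
theorem exists_int_lcm_pow_mul_coeffBs (s n : ℕ) {k : ℕ} (hk : k ≤ n) (i : ℕ) :
    ∃ z : ℤ, (Nat.lcmUpto n : ℚ) ^ (s + 2 - i) * coeffBs s n i k = z :=
  (BsReg_isDInt s n hk (s + 2 - i)).isInt (s + 2 - i) le_rfl

/-- In particular `b_{n,s+2,k} ∈ ℤ` (`k ≤ n`). [cite: Lai2025TwoAdicZeta, Lemma 4.2 (i = s+2)] -/
theorem exists_int_coeffBs_top (s n : ℕ) {k : ℕ} (hk : k ≤ n) : ∃ z : ℤ, coeffBs s n (s + 2) k = z := by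
  simpa using exists_int_lcm_pow_mul_coeffBs s n hk (s + 2)

/-! ### Existence of the expansion (def_b) and identification of its coefficients -/

/-- The list of shifts `0, …, n` repeated `c` times (the linear factors of `(t)_{n+1}^c`). [folklore] -/
def powShifts (n : ℕ) : ℕ → List ℕ
  | 0 => []
  | c + 1 => (range (n + 1)).toList ++ powShifts n c

/-- `|powShifts n c| = c(n+1)`. [folklore] -/
private theorem length_powShifts (n c : ℕ) : (powShifts n c).length = c * (n + 1) := by
  induction c with
  | zero => simp [powShifts]
  | succ c ih =>
    simp only [powShifts, List.length_append, Finset.length_toList, card_range, ih]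
    ring

/-- Every shift is `≤ n`. [folklore] -/
private theorem mem_range_of_mem_powShifts {n c i : ℕ} (hi : i ∈ powShifts n c) : i ∈ range (n + 1) := by
  induction c with
  | zero => simp [powShifts] at hi
  | succ c ih =>
    simp only [powShifts, List.mem_append, Finset.mem_toList] at hi
    exact hi.elim id ih

/-- Every shift occurs at most `c` times. [folklore] -/
private theorem count_powShifts_le (n c i : ℕ) : (powShifts n c).count i ≤ c := by
  induction c with
  | zero => simp [powShifts]
  | succ c ih =>
    have h1 : (range (n + 1)).toList.count i ≤ 1 :=
      List.nodup_iff_count_le_one.1 (Finset.nodup_toList _) i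
    simp only [powShifts, List.count_append]
    omega

/-- `∏_{i ∈ powShifts n c} (t+i)⁻¹ = (∏_{j ≤ n} (t+j))^{−c}`. [folklore] -/
private theorem prod_powShifts (n c : ℕ) (t : ℚ) :
    ((powShifts n c).map fun i : ℕ => (t + (i : ℚ))⁻¹).prod = ((∏ j ∈ range (n + 1), (t + j)) ^ c)⁻¹ := by
  induction c with
  | zero => simp [powShifts]
  | succ c ih =>
    have h1 : (((range (n + 1)).toList).map fun i : ℕ => (t + (i : ℚ))⁻¹).prod
        = (∏ j ∈ range (n + 1), (t + j))⁻¹ := by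
      rw [Finset.prod_map_toList, prod_inv_distrib]
    simp only [powShifts, List.map_append, List.prod_append, h1, ih, pow_succ]
    rw [mul_inv, mul_comm]

/-- A bound on the degree of `∏_{j<n}(X + u_j)`. [folklore] -/
private theorem natDegree_prod_X_add_C_le' (n : ℕ) (u : ℕ → ℚ) :
    (∏ j ∈ range n, (X + C (u j) : ℚ[X])).natDegree ≤ n := by
  refine (natDegree_prod_le _ _).trans ?_
  refine (sum_le_sum (g := fun _ => 1) fun j _ => (natDegree_X_add_C _).le).trans ?_
  simp

/-- EXISTENCE of an expansion of `B_n` with poles of order `≤ s+2` at `0, −1, …, −n` and no polynomial part: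
the numerator `2^{(3s+6)n}(t+¾)_n^{s+2}` has degree `(s+2)n < (s+2)(n+1)` («`B_n(t)` has degree `≤ −2`»; tree:
`exists_pfEval_eq_eval_mul_prod_inv`). [cite: Lai2025TwoAdicZeta, Definition 3.1 (def_b: the partial fractions of B_n)] -/
theorem exists_Bs_eq_pfEval (s n : ℕ) : ∃ c : ℕ → ℕ → ℚ, ∀ t : ℚ,
    (∀ i ∈ range (n + 1), t + i ≠ 0) → Bs s n t = pfEval (range (n + 1)) (fun _ => s + 2) c t := by
  classical
  set P : ℚ[X] := C ((2 : ℚ) ^ ((3 * s + 6) * n)) * (∏ j ∈ range n, (X + C ((3 : ℚ) / 4 + j))) ^ (s + 2)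
    with hP
  have hdegP : P.natDegree ≤ (s + 2) * n := by
    have h1 := (natDegree_pow_le (p := ∏ j ∈ range n, (X + C ((3 : ℚ) / 4 + j))) (n := s + 2)).trans
      (Nat.mul_le_mul_left (s + 2) (natDegree_prod_X_add_C_le' n fun j => (3 : ℚ) / 4 + j))
    exact (natDegree_C_mul_le _ _).trans h1
  have hdeg : P.natDegree < (powShifts n (s + 2)).length := by
    rw [length_powShifts]
    have : (s + 2) * n < (s + 2) * (n + 1) := Nat.mul_lt_mul_of_pos_left (Nat.lt_succ_self n) (by omega)
    omega
  obtain ⟨c, hc⟩ := exists_pfEval_eq_eval_mul_prod_inv (range (n + 1)) P (powShifts n (s + 2))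
    (fun i hi => mem_range_of_mem_powShifts hi) hdeg
  have hPeval : ∀ t : ℚ, P.eval t = 2 ^ ((3 * s + 6) * n) * (∏ j ∈ range n, (t + 3 / 4 + j)) ^ (s + 2) := by
    intro t
    rw [hP]
    simp only [eval_mul, eval_C, eval_pow, eval_prod, eval_add, eval_X]
    congr 2
    exact prod_congr rfl fun j _ => by ring
  have hB : ∀ t : ℚ, Bs s n t = P.eval t * ((powShifts n (s + 2)).map fun i : ℕ => (t + (i : ℚ))⁻¹).prod := by
    intro t
    rw [prod_powShifts, hPeval, Bs, div_eq_mul_inv]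
  have hPF : IsPF (range (n + 1)) (fun i => (powShifts n (s + 2)).count i) (Bs s n) :=
    ⟨c, fun t ht => (hB t).trans (hc t ht)⟩
  obtain ⟨c', hc'⟩ := hPF.mono fun i _ => count_powShifts_le n (s + 2) i
  exact ⟨c', hc'⟩

/-- For ANY expansion `B_n = Σ_{k ≤ n} Σ_{r ≤ s+2} c_{k,r}(t+k)^{−r}` off the poles, `c_{k,i} = b_{n,i,k}`
(`k ≤ n`, `1 ≤ i ≤ s+2`): the coefficients are the Taylor coefficients of `(t+k)^{s+2}B_n(t)` at `−k`
(«with the coefficients … uniquely determined»).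
[cite: Lai2025TwoAdicZeta, Definition 3.1 (def_b) and Lemma 4.2 (proof, first display)] -/
theorem coeffBs_eq_of_pfEval (s n : ℕ) {c : ℕ → ℕ → ℚ}
    (hc : ∀ t : ℚ, (∀ i ∈ range (n + 1), t + i ≠ 0) → Bs s n t = pfEval (range (n + 1)) (fun _ => s + 2) c t)
    {k : ℕ} (hk : k ≤ n) {i : ℕ} (hi1 : 1 ≤ i) (hi2 : i ≤ s + 2) : coeffBs s n i k = c k i := by
  have hk' : k ∈ range (n + 1) := mem_range.2 (by omega)
  have h := divDeriv_eq_coeff_of_pfEval (T := range (n + 1)) (A := s + 2) (f := Bs s n) (g := BsReg s n k)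
    (q := fun _ => 0) (c := c) hk' contDiffAt_const (fun t ht => by rw [hc t ht, zero_add])
    (contDiffAt_BsReg_neg s n k (N := 0)).continuousAt
    (fun t ht => BsReg_eq s n k ht (ht k hk')) (a := s + 2 - i) (by omega)
  rw [coeffBs, h, show s + 2 - (s + 2 - i) = i by omega]

/-- **(def_b), general `s`**: off the poles, `B_n(t) = Σ_{k=0}^{n} Σ_{i=1}^{s+2} b_{n,i,k} (t+k)^{−i}`.
[cite: Lai2025TwoAdicZeta, Definition 3.1 (the partial-fraction decomposition (def_b) of B_n)] -/
theorem Bs_eq_sum_coeffBs (s n : ℕ) {t : ℚ} (ht : ∀ j ∈ range (n + 1), t + j ≠ 0) :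
    Bs s n t = ∑ k ∈ range (n + 1), ∑ i ∈ Icc 1 (s + 2), coeffBs s n i k * ((t + k) ^ i)⁻¹ := by
  obtain ⟨c, hc⟩ := exists_Bs_eq_pfEval s n
  rw [hc t ht, pfEval]
  refine sum_congr rfl fun k hk => sum_congr rfl fun i hi => ?_
  have hi' := mem_Icc.1 hi
  rw [coeffBs_eq_of_pfEval s n hc (by have := mem_range.1 hk; omega) hi'.1 hi'.2]

/-- `b_{n,s+2,k} = P_k(−k)^{s+2}` (the value of the brick form at `−k`).
[cite: Lai2025TwoAdicZeta, Lemma 4.2 (proof: b_{n,i,k} as a Taylor coefficient, i = s+2)] -/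
theorem coeffBs_top_eq (s n k : ℕ) : coeffBs s n (s + 2) k = Pk n k (-(k : ℚ)) ^ (s + 2) := by
  rw [coeffBs, Nat.sub_self, divDeriv_zero, BsReg]


/-! ## §3. Geometric bounds for Taylor coefficients (the estimate of Lemma 5.2, general `s`)

DEVIATION (flagged): the source bounds `b_{n,i,k}` by Cauchy's integral formula on the circle `|t+k| = ⅛`.  Here the
same exponential rate `2^{(3s+6)n}` (with a polynomial factor `(5(s+2)n)^{s+2−i}` instead of the printed `10n·(100n²)^{2s+4}`)
is obtained from termwise bounds on the Taylor coefficients of the linear bricks `t + a` and `(t + a)⁻¹`, which are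
closed under products: if `|𝒟_m f(x)| ≤ M c^m` and `|𝒟_m g(x)| ≤ M′c′^m` for `m ≤ N`, then `|𝒟_m(fg)(x)| ≤ MM′(c+c′)^m`. -/

/-- `TaylorBound N f x M c`: `f` is `C^N` at `x` and its Taylor coefficients satisfy `|𝒟_m f(x)| ≤ M·c^m` for all
`m ≤ N` (`M, c ≥ 0`). [cite: Lai2025TwoAdicZeta, Lemma 5.2 (proof: the bound for max_{i,k}|b_{n,i,k}|; termwise form)] -/
structure TaylorBound (N : ℕ) (f : ℚ → ℚ) (x : ℚ) (M c : ℚ) : Prop where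
  contDiffAt : ContDiffAt ℚ N f x
  M_nonneg : 0 ≤ M
  c_nonneg : 0 ≤ c
  bound : ∀ m ≤ N, |divDeriv m f x| ≤ M * c ^ m

namespace TaylorBound

variable {N : ℕ} {f g : ℚ → ℚ} {x M c M' c' : ℚ}

/-- Weakening the constants. [cite: Lai2025TwoAdicZeta, Lemma 5.2 (proof)] -/
theorem mono (h : TaylorBound N f x M c) (hM : M ≤ M') (hc : c ≤ c') : TaylorBound N f x M' c' :=
  ⟨h.contDiffAt, h.M_nonneg.trans hM, h.c_nonneg.trans hc, fun m hm => (h.bound m hm).trans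
    (mul_le_mul hM (pow_le_pow_left₀ h.c_nonneg hc m) (pow_nonneg h.c_nonneg m) (h.M_nonneg.trans hM))⟩

/-- The germ determines the data. [cite: Lai2025TwoAdicZeta, Lemma 5.2 (proof)] -/
theorem congr (h : TaylorBound N f x M c) (hfg : f =ᶠ[𝓝 x] g) : TaylorBound N g x M c :=
  ⟨h.contDiffAt.congr_of_eventuallyEq hfg.symm, h.M_nonneg, h.c_nonneg, fun m hm => by
    rw [← divDeriv_congr hfg]; exact h.bound m hm⟩

/-- The order-`0` case: `|f(x)| ≤ M`. [cite: Lai2025TwoAdicZeta, Lemma 5.2 (proof)] -/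
theorem abs_le (h : TaylorBound N f x M c) : |f x| ≤ M := by
  simpa using h.bound 0 (Nat.zero_le _)

/-- Constants: `|𝒟_m a| ≤ |a|·0^m`. [cite: Lai2025TwoAdicZeta, Lemma 5.2 (proof)] -/
theorem const (N : ℕ) (x a : ℚ) : TaylorBound N (fun _ => a) x |a| 0 := by
  refine ⟨contDiffAt_const, abs_nonneg a, le_rfl, fun m _ => ?_⟩
  rw [divDeriv, iteratedDeriv_const]
  rcases m with _ | m
  · simp
  · simp

/-- **Products**: `|𝒟_m(fg)(x)| ≤ MM′(c+c′)^m` (Leibniz rule; `Σ_i c^i c′^{m−i} ≤ (c+c′)^m`).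
[cite: Lai2025TwoAdicZeta, Lemma 5.2 (proof: the Leibniz/termwise form of the coefficient bound)] -/
theorem mul (hf : TaylorBound N f x M c) (hg : TaylorBound N g x M' c') :
    TaylorBound N (fun t => f t * g t) x (M * M') (c + c') := by
  refine ⟨hf.contDiffAt.mul hg.contDiffAt, mul_nonneg hf.M_nonneg hg.M_nonneg,
    add_nonneg hf.c_nonneg hg.c_nonneg, fun m hm => ?_⟩
  have hfm : ContDiffAt ℚ m f x := hf.contDiffAt.of_le (by exact_mod_cast hm)
  have hgm : ContDiffAt ℚ m g x := hg.contDiffAt.of_le (by exact_mod_cast hm)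
  rw [divDeriv_fun_mul hfm hgm]
  have hMM : 0 ≤ M * M' := mul_nonneg hf.M_nonneg hg.M_nonneg
  calc |∑ i ∈ range (m + 1), divDeriv i f x * divDeriv (m - i) g x|
      ≤ ∑ i ∈ range (m + 1), |divDeriv i f x * divDeriv (m - i) g x| := abs_sum_le_sum_abs _ _
    _ ≤ ∑ i ∈ range (m + 1), c ^ i * c' ^ (m - i) * (m.choose i : ℚ) * (M * M') := by
        refine sum_le_sum fun i hi => ?_
        have him : i ≤ m := Nat.lt_succ_iff.mp (mem_range.mp hi)
        rw [abs_mul]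
        have h1 := hf.bound i (him.trans hm)
        have h2 := hg.bound (m - i) ((Nat.sub_le m i).trans hm)
        have hch : (1 : ℚ) ≤ (m.choose i : ℚ) := by exact_mod_cast Nat.choose_pos him
        have hcc : 0 ≤ c ^ i * c' ^ (m - i) := mul_nonneg (pow_nonneg hf.c_nonneg _) (pow_nonneg hg.c_nonneg _)
        calc |divDeriv i f x| * |divDeriv (m - i) g x| ≤ (M * c ^ i) * (M' * c' ^ (m - i)) :=
              mul_le_mul h1 h2 (abs_nonneg _) (mul_nonneg hf.M_nonneg (pow_nonneg hf.c_nonneg _))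
          _ = c ^ i * c' ^ (m - i) * 1 * (M * M') := by ring
          _ ≤ c ^ i * c' ^ (m - i) * (m.choose i : ℚ) * (M * M') :=
              mul_le_mul_of_nonneg_right (mul_le_mul_of_nonneg_left hch hcc) hMM
    _ = M * M' * (c + c') ^ m := by rw [← sum_mul, ← add_pow]; ring

/-- The unit. [cite: Lai2025TwoAdicZeta, Lemma 5.2 (proof)] -/
theorem one (N : ℕ) (x : ℚ) : TaylorBound N (fun _ => (1 : ℚ)) x 1 0 := by
  simpa using const N x 1

/-- **Finite products**: `|𝒟_m(∏_a f_a)(x)| ≤ (∏_a M_a)(Σ_a c_a)^m`. [cite: Lai2025TwoAdicZeta, Lemma 5.2 (proof)] -/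
theorem finset_prod {ι : Type*} (S : Finset ι) {F : ι → ℚ → ℚ} {Mf cf : ι → ℚ}
    (h : ∀ a ∈ S, TaylorBound N (F a) x (Mf a) (cf a)) :
    TaylorBound N (fun t => ∏ a ∈ S, F a t) x (∏ a ∈ S, Mf a) (∑ a ∈ S, cf a) := by
  classical
  induction S using Finset.induction_on with
  | empty => simpa using one N x
  | insert a S ha ih =>
    have h1 := h a (mem_insert_self a S)
    have h2 := ih fun b hb => h b (mem_insert_of_mem hb)
    have h12 := h1.mul h2
    rw [prod_insert ha, sum_insert ha]
    refine h12.congr (Eventually.of_forall fun t => ?_)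
    simp only [prod_insert ha]

/-- **Powers**: `|𝒟_m(f^p)(x)| ≤ M^p (p c)^m`. [cite: Lai2025TwoAdicZeta, Lemma 5.2 (proof)] -/
theorem pow (h : TaylorBound N f x M c) (p : ℕ) : TaylorBound N (fun t => f t ^ p) x (M ^ p) (p * c) := by
  induction p with
  | zero => simpa using one N x
  | succ p ih =>
    have h12 := ih.mul h
    refine (h12.congr (Eventually.of_forall fun t => ?_)).mono (le_of_eq ?_) (le_of_eq ?_)
    · simp only [pow_succ]
    · rw [pow_succ]
    · push_cast; ring

/-- A LINEAR BRICK `t + a` at `x` with `x + a ≠ 0`: `𝒟_0 = x+a`, `𝒟_1 = 1`, `𝒟_m = 0` (`m ≥ 2`), so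
`|𝒟_m| ≤ |x+a|·|x+a|^{−m}`. [cite: Lai2025TwoAdicZeta, Lemma 5.2 (proof: the factors of (t+¾)_n)] -/
theorem linear (N : ℕ) {x : ℚ} (a : ℚ) (h : x + a ≠ 0) :
    TaylorBound N (fun t => t + a) x |x + a| |x + a|⁻¹ := by
  refine ⟨contDiffAt_id.add contDiffAt_const, abs_nonneg _, inv_nonneg.2 (abs_nonneg _), fun m _ => ?_⟩
  have key : iteratedDeriv m (fun t : ℚ => t + a) x = if m = 0 then x + a else if m = 1 then 1 else 0 := by
    have e : (fun t : ℚ => t + a) = fun t => 1 * t + a := by funext t; ring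
    rw [e, iteratedDeriv_affine 1 a x m]
    simp
  have hxa : 0 < |x + a| := abs_pos.2 h
  rw [divDeriv, key]
  rcases m with _ | _ | m
  · simp
  · simp [mul_inv_cancel₀ hxa.ne']
  · simp only [show m + 1 + 1 ≠ 0 by omega, show m + 1 + 1 ≠ 1 by omega, if_false, zero_div, abs_zero]
    positivity

/-- An INVERSE LINEAR BRICK `(t + a)⁻¹` at `x` with `x + a ≠ 0`: `|𝒟_m| = |x+a|^{−1}·|x+a|^{−m}` (tree
`divDeriv_inv_add_const`). [cite: Lai2025TwoAdicZeta, Lemma 5.2 (proof: the factors of (t)_{n+1}^{−1})] -/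
theorem invLinear (N : ℕ) {x : ℚ} (a : ℚ) (h : x + a ≠ 0) :
    TaylorBound N (fun t => (t + a)⁻¹) x |x + a|⁻¹ |x + a|⁻¹ := by
  refine ⟨contDiffAt_inv_add_const h, inv_nonneg.2 (abs_nonneg _), inv_nonneg.2 (abs_nonneg _),
    fun m _ => le_of_eq ?_⟩
  rw [divDeriv_inv_add_const m h, abs_div, abs_pow, abs_pow, abs_neg, abs_one, one_pow, ← pow_succ', one_div,
    inv_pow]

end TaylorBound

/-! ### The geometric data of `P_k` and of `(t+k)^{s+2}B_n` at `−k`, and the bound for `b_{n,i,k}` -/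

/-- The RATE `c_P(n,k) := Σ_{j<n} |j − k + ¾|^{−1} + Σ_{l ≤ n, l ≠ k} |l − k|^{−1}` of the brick product `P_k` at `−k`.
[cite: Lai2025TwoAdicZeta, Lemma 5.2 (proof)] -/
def cP (n k : ℕ) : ℚ :=
  ∑ j ∈ range n, |(-(k : ℚ)) + ((((3 : ℤ) : ℚ)) / 4 + j)|⁻¹ +
    ∑ l ∈ (range (n + 1)).filter (fun l => l ≠ k), |(-(k : ℚ)) + l|⁻¹

/-- `c_P(n,k) ≥ 0`. [cite: Lai2025TwoAdicZeta, Lemma 5.2 (proof)] -/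
theorem cP_nonneg (n k : ℕ) : 0 ≤ cP n k :=
  add_nonneg (sum_nonneg fun _ _ => inv_nonneg.2 (abs_nonneg _)) (sum_nonneg fun _ _ => inv_nonneg.2 (abs_nonneg _))

/-- **`c_P(n,k) ≤ 5n`**: each of the `n` quarter factors has `|j − k + ¾| ≥ ¼`, each of the `n` integer factors
`|l − k| ≥ 1`. [cite: Lai2025TwoAdicZeta, Lemma 5.2 (proof)] -/
theorem cP_le (n : ℕ) {k : ℕ} (hk : k ≤ n) : cP n k ≤ 5 * n := by
  have h1 : ∑ j ∈ range n, |(-(k : ℚ)) + ((((3 : ℤ) : ℚ)) / 4 + j)|⁻¹ ≤ ∑ _j ∈ range n, (4 : ℚ) := by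
    refine sum_le_sum fun j _ => ?_
    have hq : (1 / 4 : ℚ) ≤ |(-(k : ℚ)) + ((((3 : ℤ) : ℚ)) / 4 + j)| := by
      rcases Nat.lt_or_ge j k with hkj | hkj
      · have : (j : ℚ) + 1 ≤ k := by exact_mod_cast hkj
        rw [abs_of_neg (by push_cast; linarith)]; push_cast; linarith
      · have : (k : ℚ) ≤ j := by exact_mod_cast hkj
        rw [abs_of_nonneg (by push_cast; linarith)]; push_cast; linarith
    calc |(-(k : ℚ)) + ((((3 : ℤ) : ℚ)) / 4 + j)|⁻¹ ≤ (1 / 4 : ℚ)⁻¹ := by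
          exact inv_anti₀ (by norm_num) hq
      _ = 4 := by norm_num
  have h2 : ∑ l ∈ (range (n + 1)).filter (fun l => l ≠ k), |(-(k : ℚ)) + l|⁻¹ ≤
      ∑ _l ∈ (range (n + 1)).filter (fun l => l ≠ k), (1 : ℚ) := by
    refine sum_le_sum fun l hl => ?_
    have hlk : l ≠ k := (mem_filter.1 hl).2
    have hq : (1 : ℚ) ≤ |(-(k : ℚ)) + l| := by
      rw [show (-(k : ℚ) + l) = (((l : ℤ) - k : ℤ) : ℚ) by push_cast; ring, ← Int.cast_abs]
      have : (1 : ℤ) ≤ |(l : ℤ) - k| := Int.one_le_abs (sub_ne_zero.2 (by exact_mod_cast hlk))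
      exact_mod_cast this
    calc |(-(k : ℚ)) + l|⁻¹ ≤ (1 : ℚ)⁻¹ := inv_anti₀ (by norm_num) hq
      _ = 1 := inv_one
  have hcard : ((range (n + 1)).filter (fun l => l ≠ k)).card = n := by
    rw [filter_ne', card_erase_of_mem (mem_range.2 (by omega)), card_range]; rfl
  rw [cP]
  refine (add_le_add h1 h2).trans ?_
  rw [sum_const, sum_const, card_range, hcard, nsmul_eq_mul, nsmul_eq_mul]
  ring_nf
  rfl

/-- **The geometric data of `P_k` at `−k`** (`k ≤ n`): `|𝒟_m P_k(−k)| ≤ |P_k(−k)|·c_P(n,k)^m` for all `m` —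
`P_k = (2^{3n}/n!)·∏_{j<n}(t + ¾ + j)·n!·∏_{l≠k}(t+l)^{−1}` is a product of a constant, `n` linear bricks and
`n` inverse linear bricks. [cite: Lai2025TwoAdicZeta, Lemma 5.2 (proof)] -/
theorem taylorBound_Pk (n : ℕ) {k : ℕ} (hk : k ≤ n) (N : ℕ) :
    TaylorBound N (Pk n k) (-(k : ℚ)) |Pk n k (-(k : ℚ))| (cP n k) := by
  classical
  set x : ℚ := -(k : ℚ) with hx
  -- the four factors
  have hA := TaylorBound.const N x ((2 : ℚ) ^ (3 * n) / (n ! : ℚ))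
  have hquart : ∀ j ∈ range n, x + ((((3 : ℤ) : ℚ)) / 4 + j) ≠ 0 := fun j _ => by
    rw [hx]; exact neg_add_quarter_ne_zero k j
  have hB := TaylorBound.finset_prod (N := N) (x := x) (range n)
    (F := fun j t => t + ((((3 : ℤ) : ℚ)) / 4 + j)) (fun j hj => TaylorBound.linear N _ (hquart j hj))
  have hC := TaylorBound.const N x (n ! : ℚ)
  have hint : ∀ l ∈ (range (n + 1)).filter (fun l => l ≠ k), x + (l : ℚ) ≠ 0 := fun l hl => by
    rw [hx]; exact neg_add_ne_zero_of_ne' (mem_filter.1 hl).2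
  have hD := TaylorBound.finset_prod (N := N) (x := x) ((range (n + 1)).filter (fun l => l ≠ k))
    (F := fun l t => (t + (l : ℚ))⁻¹) (fun l hl => TaylorBound.invLinear N _ (hint l hl))
  have hP := (hA.mul hB).mul (hC.mul hD)
  -- `Pk n k` is this product of functions
  have hP' : TaylorBound N (Pk n k) x _ _ := hP.congr (Eventually.of_forall fun t => by
    show (2 : ℚ) ^ (3 * n) / (n ! : ℚ) * (∏ j ∈ range n, (t + ((((3 : ℤ) : ℚ)) / 4 + j))) *
      ((n ! : ℚ) * ∏ l ∈ (range (n + 1)).filter (fun l => l ≠ k), (t + (l : ℚ))⁻¹) = Pk n k t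
    rw [Pk, quarterBrick, Greg_eq n hk t])
  -- the constants: `M = |P_k(−k)|`, `c = c_P`
  have hM : |(2 : ℚ) ^ (3 * n) / (n ! : ℚ)| * (∏ j ∈ range n, |x + ((((3 : ℤ) : ℚ)) / 4 + j)|) *
      (|(n ! : ℚ)| * ∏ l ∈ (range (n + 1)).filter (fun l => l ≠ k), |x + (l : ℚ)|⁻¹) = |Pk n k x| := by
    rw [Pk, quarterBrick, Greg_eq n hk x, abs_mul, abs_mul, abs_mul, abs_prod, abs_prod]
    congr 2
    exact prod_congr rfl fun l _ => (abs_inv _).symm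
  have hc : (0 : ℚ) + ∑ j ∈ range n, |x + ((((3 : ℤ) : ℚ)) / 4 + j)|⁻¹ +
      (0 + ∑ l ∈ (range (n + 1)).filter (fun l => l ≠ k), |x + (l : ℚ)|⁻¹) = cP n k := by
    rw [cP, hx]; ring
  exact hP'.mono (le_of_eq hM) (le_of_eq hc)

/-- **The geometric data of `(t+k)^{s+2}B_n(t)` at `−k`**: `|𝒟_m(P_k^{s+2})(−k)| ≤ 2^{(3s+6)n}((s+2)c_P)^m`
(`|P_k(−k)| ≤ 2^{3n}`, tree `abs_Pk_neg_le`). [cite: Lai2025TwoAdicZeta, Lemma 5.2 (proof: max|b_{n,i,k}| ≤ 2^{(3s+6+o(1))n})] -/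
theorem taylorBound_BsReg (s n : ℕ) {k : ℕ} (hk : k ≤ n) (N : ℕ) :
    TaylorBound N (BsReg s n k) (-(k : ℚ)) ((2 : ℚ) ^ ((3 * s + 6) * n)) ((s + 2 : ℕ) * cP n k) := by
  have h := ((taylorBound_Pk n hk N).pow (s + 2)).mono
    (M' := (2 : ℚ) ^ ((3 * s + 6) * n)) (c' := ((s + 2 : ℕ) : ℚ) * cP n k) ?_ le_rfl
  · exact h.congr (Eventually.of_forall fun t => by rw [BsReg])
  · calc |Pk n k (-(k : ℚ))| ^ (s + 2) ≤ ((2 : ℚ) ^ (3 * n)) ^ (s + 2) :=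
          pow_le_pow_left₀ (abs_nonneg _) (abs_Pk_neg_le n hk) _
      _ = (2 : ℚ) ^ ((3 * s + 6) * n) := by rw [← pow_mul]; ring_nf

/-- **Lemma 5.2 for the coefficients (general `s`), explicit form:** `|b_{n,i,k}| ≤ 2^{(3s+6)n}·((s+2)c_P(n,k))^{s+2−i}`
(`k ≤ n`). [cite: Lai2025TwoAdicZeta, Lemma 5.2 (proof: "It suffices to show max_{i,k}|a_{n,i,k}| ≤ 2^{(6s+12+o(1))n}", B-version)] -/
theorem abs_coeffBs_le_cP (s n : ℕ) {k : ℕ} (hk : k ≤ n) (i : ℕ) :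
    |coeffBs s n i k| ≤ (2 : ℚ) ^ ((3 * s + 6) * n) * (((s + 2 : ℕ) : ℚ) * cP n k) ^ (s + 2 - i) := by
  rw [coeffBs]
  exact (taylorBound_BsReg s n hk (s + 2 - i)).bound (s + 2 - i) le_rfl

/-- **Lemma 5.2 for the coefficients (general `s`):** `|b_{n,i,k}| ≤ 2^{(3s+6)n}·(5(s+2)n)^{s+2−i}` (`k ≤ n`) — the
printed `max_{i,k}|b_{n,i,k}| ≤ 2^{(3s+6+o(1))n}` with an explicit polynomial factor.
[cite: Lai2025TwoAdicZeta, Lemma 5.2 (sigma_est), proof] -/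
theorem abs_coeffBs_le (s n : ℕ) {k : ℕ} (hk : k ≤ n) (i : ℕ) :
    |coeffBs s n i k| ≤ (2 : ℚ) ^ ((3 * s + 6) * n) * (5 * ((s + 2 : ℕ) : ℚ) * n) ^ (s + 2 - i) := by
  refine (abs_coeffBs_le_cP s n hk i).trans (mul_le_mul_of_nonneg_left ?_ (by positivity))
  refine pow_le_pow_left₀ (mul_nonneg (by positivity) (cP_nonneg n k)) ?_ _
  calc ((s + 2 : ℕ) : ℚ) * cP n k ≤ ((s + 2 : ℕ) : ℚ) * (5 * n) :=
        mul_le_mul_of_nonneg_left (cP_le n hk) (by positivity)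
    _ = 5 * ((s + 2 : ℕ) : ℚ) * n := by ring


/-! ## §4. `σ_{n,1} = 0`: `Σ_k b_{n,1,k} = lim_{t→∞} tB_n(t) = 0` (deg `B_n ≤ −2`, general `s`) -/

/-- `0 ≤ B_n(N)` and `B_n(N) ≤ 2^{(3s+6)n}/N²` for a natural number `N ≥ 1` (each factor `N+¾+j ≤ N+1+j`, and
`(t)_{n+1} = t·∏_{j<n}(t+1+j)`; in `ℝ`). [cite: Lai2025TwoAdicZeta, Definition 3.1 (deg B_n ≤ −2)] -/
theorem Bs_natCast_bounds (s n : ℕ) {N : ℕ} (hN : 1 ≤ N) :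
    0 ≤ (Bs s n N : ℝ) ∧ (Bs s n N : ℝ) ≤ 2 ^ ((3 * s + 6) * n) / (N : ℝ) ^ 2 := by
  have hN0 : (1 : ℝ) ≤ N := by exact_mod_cast hN
  have hcast : (Bs s n N : ℝ) = 2 ^ ((3 * s + 6) * n) * (∏ j ∈ range n, ((N : ℝ) + 3 / 4 + j)) ^ (s + 2) /
      (∏ j ∈ range (n + 1), ((N : ℝ) + j)) ^ (s + 2) := by
    rw [Bs]; push_cast; ring
  have hA0 : 0 ≤ ∏ j ∈ range n, ((N : ℝ) + 3 / 4 + j) := prod_nonneg fun j _ => by positivity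
  have hB : ∏ j ∈ range (n + 1), ((N : ℝ) + j) = N * ∏ j ∈ range n, ((N : ℝ) + 1 + j) := by
    rw [Finset.prod_range_succ']
    push_cast
    rw [add_zero, mul_comm]
    congr 1
    exact prod_congr rfl fun j _ => by ring
  have hC0 : 0 < ∏ j ∈ range n, ((N : ℝ) + 1 + j) := prod_pos fun j _ => by positivity
  have hAC : ∏ j ∈ range n, ((N : ℝ) + 3 / 4 + j) ≤ ∏ j ∈ range n, ((N : ℝ) + 1 + j) :=
    prod_le_prod (fun j _ => by positivity) fun j _ => by linarith
  rw [hcast, hB]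
  constructor
  · positivity
  · rw [mul_pow, div_le_div_iff₀ (by positivity) (by positivity)]
    have h4 : (∏ j ∈ range n, ((N : ℝ) + 3 / 4 + j)) ^ (s + 2) ≤ (∏ j ∈ range n, ((N : ℝ) + 1 + j)) ^ (s + 2) :=
      pow_le_pow_left₀ hA0 hAC _
    have hN2 : (N : ℝ) ^ 2 ≤ (N : ℝ) ^ (s + 2) := pow_le_pow_right₀ hN0 (by omega)
    calc 2 ^ ((3 * s + 6) * n) * (∏ j ∈ range n, ((N : ℝ) + 3 / 4 + j)) ^ (s + 2) * (N : ℝ) ^ 2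
        ≤ 2 ^ ((3 * s + 6) * n) * (∏ j ∈ range n, ((N : ℝ) + 1 + j)) ^ (s + 2) * (N : ℝ) ^ (s + 2) := by
          gcongr
      _ = 2 ^ ((3 * s + 6) * n) * ((N : ℝ) ^ (s + 2) * (∏ j ∈ range n, ((N : ℝ) + 1 + j)) ^ (s + 2)) := by ring

/-- `N·B_n(N) → 0` as `N → ∞` ("`σ_{n,1} = 0` since `deg B_n ≤ −2`"). [cite: Lai2025TwoAdicZeta, Lemma 3.3 (proof, last paragraph)] -/
private theorem tendsto_natCast_mul_Bs (s n : ℕ) :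
    Tendsto (fun N : ℕ => (N : ℝ) * (Bs s n N : ℝ)) atTop (𝓝 0) := by
  have hup : Tendsto (fun N : ℕ => (2 : ℝ) ^ ((3 * s + 6) * n) / (N : ℝ)) atTop (𝓝 0) :=
    tendsto_const_div_atTop_nhds_zero_nat _
  refine squeeze_zero' ?_ ?_ hup
  · filter_upwards [eventually_ge_atTop 1] with N hN
    exact mul_nonneg (Nat.cast_nonneg N) (Bs_natCast_bounds s n hN).1
  · filter_upwards [eventually_ge_atTop 1] with N hN
    have hN0 : (0 : ℝ) < N := by exact_mod_cast hN
    have h := (Bs_natCast_bounds s n hN).2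
    calc (N : ℝ) * (Bs s n N : ℝ) ≤ N * (2 ^ ((3 * s + 6) * n) / (N : ℝ) ^ 2) :=
          mul_le_mul_of_nonneg_left h hN0.le
      _ = 2 ^ ((3 * s + 6) * n) / (N : ℝ) := by field_simp

/-- **`σ_{n,1} = 0`**, i.e. `Σ_{k=0}^{n} b_{n,1,k} = 0` («we have `σ_{n,1} = 0` since `deg B_n(t) ≤ −2`»:
`Σ_k b_{n,1,k} = lim_{t→∞} tB_n(t) = 0`, while `t·(t+k)^{−i} → 0` for `i ≥ 2`).
[cite: Lai2025TwoAdicZeta, Lemma 3.3 (proof: σ_{n,1} = 0)] -/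
theorem sum_coeffBs_one_eq_zero (s n : ℕ) : ∑ k ∈ range (n + 1), coeffBs s n 1 k = 0 := by
  set L : ℕ → ℕ → ℝ := fun i k => if i = 1 then (coeffBs s n 1 k : ℝ) else 0 with hL
  have hterm : ∀ k ∈ range (n + 1), ∀ i ∈ (Icc 1 (s + 2) : Finset ℕ),
      Tendsto (fun N : ℕ => (N : ℝ) * ((coeffBs s n i k : ℝ) * (((N : ℝ) + k) ^ i)⁻¹)) atTop (𝓝 (L i k)) := by
    intro k _ i hi
    have h1 : Tendsto (fun N : ℕ => (N : ℝ) / ((N : ℝ) + k)) atTop (𝓝 1) := tendsto_natCast_div_add_atTop (k : ℝ)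
    by_cases hi' : i = 1
    · subst hi'
      simp only [hL, if_true, pow_one]
      have := h1.const_mul (coeffBs s n 1 k : ℝ)
      rw [mul_one] at this
      refine this.congr fun N => ?_
      ring
    · simp only [hL, if_neg hi']
      have hi2 : 2 ≤ i := by have := mem_Icc.1 hi; omega
      obtain ⟨r, rfl⟩ : ∃ r, i = r + 1 := ⟨i - 1, by omega⟩
      have h2 : Tendsto (fun N : ℕ => (((N : ℝ) + k) ^ r)⁻¹) atTop (𝓝 0) := by
        have ht : Tendsto (fun N : ℕ => ((N : ℝ) + k) ^ r) atTop atTop := by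
          refine (tendsto_pow_atTop (by omega)).comp ?_
          exact tendsto_atTop_add_const_right _ _ tendsto_natCast_atTop_atTop
        exact ht.inv_tendsto_atTop
      have h := (h1.mul h2).const_mul (coeffBs s n (r + 1) k : ℝ)
      rw [one_mul, mul_zero] at h
      refine h.congr' ?_
      filter_upwards [eventually_ge_atTop 1] with N hN
      have hNk : ((N : ℝ) + k) ≠ 0 := by positivity
      rw [pow_succ]
      field_simp
  have hsum : Tendsto (fun N : ℕ => (N : ℝ) * ∑ k ∈ range (n + 1), ∑ i ∈ (Icc 1 (s + 2) : Finset ℕ),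
      (coeffBs s n i k : ℝ) * (((N : ℝ) + k) ^ i)⁻¹) atTop
      (𝓝 (∑ k ∈ range (n + 1), ∑ i ∈ (Icc 1 (s + 2) : Finset ℕ), L i k)) := by
    have h := tendsto_finsetSum (range (n + 1)) fun k hk =>
      tendsto_finsetSum (Icc 1 (s + 2) : Finset ℕ) fun i hi => hterm k hk i hi
    refine h.congr fun N => ?_
    rw [mul_sum]
    exact sum_congr rfl fun k _ => by rw [mul_sum]
  have hLsum : ∑ k ∈ range (n + 1), ∑ i ∈ (Icc 1 (s + 2) : Finset ℕ), L i k =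
      ((∑ k ∈ range (n + 1), coeffBs s n 1 k : ℚ) : ℝ) := by
    push_cast
    refine sum_congr rfl fun k _ => ?_
    rw [sum_ite_eq' (Icc 1 (s + 2) : Finset ℕ) 1 (fun _ => (coeffBs s n 1 k : ℝ)), if_pos (by simp)]
  have heq : ∀ᶠ N : ℕ in atTop, (N : ℝ) * (Bs s n N : ℝ) =
      (N : ℝ) * ∑ k ∈ range (n + 1), ∑ i ∈ (Icc 1 (s + 2) : Finset ℕ),
        (coeffBs s n i k : ℝ) * (((N : ℝ) + k) ^ i)⁻¹ := by
    filter_upwards [eventually_ge_atTop 1] with N hN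
    have hne : ∀ j ∈ range (n + 1), (N : ℚ) + j ≠ 0 := fun j _ => by positivity
    rw [Bs_eq_sum_coeffBs s n hne]
    push_cast
    rfl
  have hlim := (tendsto_natCast_mul_Bs s n).congr' heq
  have huniq := tendsto_nhds_unique hlim hsum
  rw [hLsum] at huniq
  exact_mod_cast huniq.symm

/-! ## §5. `B_n` on the quarter-shifted line: `B_n(x+¼) = 2^{(5s+10)n+2s+4}·((x+1)⋯(x+n))^{s+2}/∏_{k≤n}(4x+4k+1)^{s+2}` -/

/-- **`B_n(x + ¼)` in product form**: `B_n(x+¼) = 2^{(5s+10)n+2s+4} · (∏_{j<n}(x+1+j))^{s+2} / (∏_{j≤n}(4x+4j+1))^{s+2}`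
— the display «`B_n(t+¼) = 2^{(5s+10)n+2s+4}·f(t)`, `f(t) = (t+1)^{s+2}⋯(t+n)^{s+2} g(t)`,
`g(t) = ∏_{k=0}^{n}(4t+4k+1)^{−(s+2)}`» (valid for every rational `x` off the shifted poles).
[cite: Lai2025TwoAdicZeta, Lemma 6.3 (proof, the displays for B_n(t+¼), f, g)] -/
theorem Bs_add_quarter (s n : ℕ) (x : ℚ) :
    Bs s n (x + 1 / 4) = (2 : ℚ) ^ ((5 * s + 10) * n + 2 * s + 4) * (∏ j ∈ range n, (x + 1 + j)) ^ (s + 2) /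
      (∏ j ∈ range (n + 1), (4 * x + 4 * j + 1)) ^ (s + 2) := by
  have hnum : ∏ j ∈ range n, (x + 1 / 4 + 3 / 4 + j) = ∏ j ∈ range n, (x + 1 + j) :=
    prod_congr rfl fun j _ => by ring
  have hden : ∏ j ∈ range (n + 1), (x + 1 / 4 + j) =
      (∏ j ∈ range (n + 1), (4 * x + 4 * j + 1)) / (4 : ℚ) ^ (n + 1) := by
    calc ∏ j ∈ range (n + 1), (x + 1 / 4 + j) = ∏ j ∈ range (n + 1), ((4 * x + 4 * j + 1) / 4) :=
          prod_congr rfl fun j _ => by ring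
      _ = (∏ j ∈ range (n + 1), (4 * x + 4 * j + 1)) / ∏ _j ∈ range (n + 1), (4 : ℚ) :=
          prod_div_distrib _ _
      _ = _ := by rw [prod_const, card_range]
  have h4 : ((4 : ℚ) ^ (n + 1)) ^ (s + 2) = 2 ^ (2 * (n + 1) * (s + 2)) := by
    rw [show (4 : ℚ) = 2 ^ 2 by norm_num, ← pow_mul, ← pow_mul, mul_assoc]
  rw [Bs, hnum, hden, div_pow, div_div_eq_mul_div]
  by_cases hP : (∏ j ∈ range (n + 1), (4 * x + 4 * j + 1)) ^ (s + 2) = 0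
  · rw [hP, div_zero, div_zero]
  · rw [div_left_inj' hP, h4, mul_assoc, mul_comm (_ ^ (s + 2)) (_), ← mul_assoc, ← pow_add]
    congr 2
    ring

/-- The natural-number instance: `B_n(m+¼) = 2^{(5s+10)n+2s+4} (n!·binom(m+n,n))^{s+2} / ∏_{j≤n}(4m+4j+1)^{s+2}`
(`(m+1)⋯(m+n) = n!·binom(m+n,n)`, tree `prod_range_add_one_add`). [cite: Lai2025TwoAdicZeta, Lemma 6.3 (proof: f = n!^{2+j} binom(t+n,n)^{2+j} ⋯)] -/
theorem Bs_natCast_add_quarter (s n m : ℕ) :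
    Bs s n ((m : ℚ) + 1 / 4) = (2 : ℚ) ^ ((5 * s + 10) * n + 2 * s + 4) *
      ((n ! : ℚ) * ((m + n).choose n : ℚ)) ^ (s + 2) / (∏ j ∈ range (n + 1), (4 * (m : ℚ) + 4 * j + 1)) ^ (s + 2) := by
  rw [Bs_add_quarter, prod_range_add_one_add]

end Literature.NumberTheory.Irrationality.Lai2025TwoAdic
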